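import Mathlib
import Summits.Ventures.PercRepro2.Defs
import Summits.Ventures.PercRepro2.Independence
import Summits.Ventures.PercRepro2.Harris
import Summits.Ventures.PercRepro2.Graph
import Summits.Ventures.PercRepro2.Exploration
import Summits.Ventures.PercRepro2.Events
import Summits.Ventures.PercRepro2.Statements
import Summits.Ventures.PercRepro2.FourFunctions
import Summits.Ventures.PercRepro2.Induced
import Summits.Ventures.PercRepro2.Frontier
import Summits.Ventures.PercRepro2.ObsIndependence
import Summits.Ventures.PercRepro2.BHK
import Summits.Ventures.PercRepro2.BHKEvents
import Summits.Ventures.PercRepro2.OrderPreservation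
import Summits.Ventures.PercRepro2.VdBKahn
import Summits.Ventures.PercRepro2.KNTwo
import Summits.Ventures.PercRepro2.BHKAvoid
import Summits.Ventures.PercRepro2.R4Defs

/-!
# R4+ at `|A| = 2` reduces to (H2) (blind cell PercRepro2, p1; T2-a, partial)

R4+ at `A = {a₁, a₂}` (GQ form, `R4PlusTwo`): `P(a₁ ↔ b) ≤ P(o ↔ A, o ↔ b) + GQ(b)` with
`GQ(b) = ∑_{W ∩ A = ∅} P(C(o) = W) · min_a P_{G∖W}(a ↔ b)` (`gqTerm`). Expanding `P(a₁ ↔ b)` over the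
cluster `W = C(o)` (`prob_inter_eq_sum_clusterEvent`, domain Markov) and writing
`x = min(x, y) + (x − y)⁺`, R4+ becomes `P(o ∈ U, a₁ ∉ U, b ∉ U, a₁ ↔ b) + LOSS ≤ P(o ∈ U, b ∈ U, a₁ ∉ U)`
with `U = C(a₂)` and `LOSS = lossTerm`; the first term is `≤ ρ₀ · P(o ∈ U, a₁, b ∉ U)` by the
cross-cluster inequality with the avoidance `{a₁, b}` (`t1_nonneg`, BHKAvoid.lean), so the lead's
(H2) `ρ₀ · P(o ∈ U, a₁, b ∉ U) + LOSS ≤ P(o ∈ U, b ∈ U, a₁ ∉ U)` implies R4+ (`r4PlusTwo_of_H2`).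
(H2) itself is OPEN (0/169,614 at n = 6, lead); it is the exact residual.
-/

namespace Summit.Ventures.PercRepro2

/-! ## R4+ at `|A| = 2` reduces to the lead's (H2) -/

section R4PlusTwo

variable {V : Type*} {E : Type*} [Fintype E] [DecidableEq E] [Fintype V] [DecidableEq V]
  {R : Type*} [Field R] [LinearOrder R] [IsStrictOrderedRing R]

omit [DecidableEq E] in
/-- `↑(clusterFinset) = cluster`. -/
lemma coe_clusterFinset (ends : E → Sym2 V) (o : V) (ω : Config E) :
    (↑(clusterFinset ends o ω) : Set V) = cluster ends ω o := by
  ext x; simp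

omit [DecidableEq E] in
/-- `{C(o) = W}` is the level set of `clusterFinset`. -/
lemma clusterEvent_eq_level (ends : E → Sym2 V) (o : V) (W : Finset V) :
    clusterEvent ends o ↑W = {ω | clusterFinset ends o ω = W} := by
  ext ω
  simp only [mem_clusterEvent, Set.mem_setOf_eq, ← coe_clusterFinset, Finset.coe_inj]

omit [LinearOrder R] [IsStrictOrderedRing R] in
/-- **Partition by the cluster of `o`**: `P({q(C(o))} ∩ X) = ∑_{W : q W} P(C(o) = W, X)`. -/
theorem prob_inter_eq_sum_clusterEvent (p : E → R) (ends : E → Sym2 V) (o : V)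
    (q : Finset V → Prop) [DecidablePred q] (X : Set (Config E)) :
    prob p ({ω | q (clusterFinset ends o ω)} ∩ X) =
      ∑ W ∈ (Finset.univ : Finset (Finset V)).filter q, prob p (clusterEvent ends o ↑W ∩ X) := by
  classical
  have hpt : ∀ ω, ({ω | q (clusterFinset ends o ω)} ∩ X).indicator (weight p) ω =
      ∑ W ∈ (Finset.univ : Finset (Finset V)).filter q,
        (clusterEvent ends o ↑W ∩ X).indicator (weight p) ω := by
    intro ω
    by_cases hq : q (clusterFinset ends o ω)
    · rw [Finset.sum_eq_single (clusterFinset ends o ω)]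
      · simp only [clusterEvent_eq_level]
        by_cases hX : ω ∈ X
        · rw [Set.indicator_of_mem (show ω ∈ {ω | q (clusterFinset ends o ω)} ∩ X from ⟨hq, hX⟩),
            Set.indicator_of_mem (show ω ∈ {ω' | clusterFinset ends o ω' = clusterFinset ends o ω}
              ∩ X from ⟨rfl, hX⟩)]
        · rw [Set.indicator_of_notMem (show ω ∉ {ω | q (clusterFinset ends o ω)} ∩ X from
            fun h => hX h.2), Set.indicator_of_notMem (show ω ∉ {ω' | clusterFinset ends o ω' =
            clusterFinset ends o ω} ∩ X from fun h => hX h.2)]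
      · intro W _ hW
        rw [Set.indicator_of_notMem]
        rintro ⟨h, _⟩
        rw [clusterEvent_eq_level] at h
        exact hW h.symm
      · intro hmem
        exact absurd (Finset.mem_filter.2 ⟨Finset.mem_univ _, hq⟩) hmem
    · rw [Set.indicator_of_notMem (show ω ∉ {ω | q (clusterFinset ends o ω)} ∩ X from
        fun h => hq h.1), eq_comm]
      refine Finset.sum_eq_zero fun W hW => ?_
      rw [Set.indicator_of_notMem]
      rintro ⟨h, _⟩
      rw [clusterEvent_eq_level] at h
      exact hq (h ▸ (Finset.mem_filter.1 hW).2)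
  unfold prob
  simp_rw [hpt]
  rw [Finset.sum_comm]

omit [Fintype E] [DecidableEq E] [Fintype V] [DecidableEq V] in
/-- `min x y + (x − y)⁺ = x`. -/
lemma min_add_max_sub (x y : R) : min x y + max 0 (x - y) = x := by
  rcases le_total x y with h | h
  · rw [min_eq_left h, max_eq_left (by linarith), add_zero]
  · rw [min_eq_right h, max_eq_right (by linarith)]; ring

/-- **T1 ≥ 0**: `P(o ∈ U, a₁ ∉ U, b ∉ U, a₁ ↔ b) ≤ ρ₀ · P(o ∈ U, a₁ ∉ U, b ∉ U)` — the cross-cluster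
inequality at the roots `a₂` (event `{o ∈ U}`) and `a₁` (event `{a₁ ↔ b}`) with `a₂ ↮ {a₁, b}`. -/
theorem t1_nonneg (p : E → R) (hp : IsProbVec p) (ends : E → Sym2 V) (o a₁ a₂ b : V) :
    prob p (connEvent ends o a₂ ∩ connEvent ends a₁ b ∩ avoidAll ends a₂ {a₁, b}) ≤
      rhoZero p ends a₁ a₂ b * prob p (connEvent ends o a₂ ∩ avoidAll ends a₂ {a₁, b}) := by
  have key := bhk_cross_cluster_avoid p hp ends a₂ a₁ (X := {a₁, b}) (Finset.mem_insert_self _ _)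
    (isUpperSet_mem_setOf o) (isUpperSet_mem_setOf b)
  rw [clusterInEvent_mem_eq_connEvent, clusterInEvent_mem_eq_connEvent,
    connEvent_comm ends b a₁] at key
  unfold rhoZero
  rcases (prob_nonneg hp (avoidAll ends a₂ {a₁, b})).lt_or_eq with hd | hd
  · rw [div_mul_eq_mul_div, le_div_iff₀ hd]
    linarith
  · rw [← hd, div_zero, zero_mul]
    refine le_trans (prob_mono hp (Set.inter_subset_right)) ?_
    rw [← hd]

/-- **Reduction**: (H2) implies R4+ at `|A| = 2` (no hypothesis on the order of `P(a ↔ b)` is used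
here; it is needed for (H2) itself). -/
theorem r4PlusTwo_of_H2 (p : E → R) (hp : IsProbVec p) (ends : E → Sym2 V) {o a₁ a₂ b : V}
    (hH2 : H2 p ends o a₁ a₂ b) : R4PlusTwo p ends o a₁ a₂ b := by
  classical
  unfold R4PlusTwo
  -- expand `P(a₁ ↔ b)` over the cluster of `o`
  have e0 : prob p (connEvent ends a₁ b) =
      prob p ({ω | a₁ ∈ clusterFinset ends o ω} ∩ connEvent ends a₁ b) +
      prob p ({ω | a₁ ∉ clusterFinset ends o ω ∧ a₂ ∈ clusterFinset ends o ω} ∩ connEvent ends a₁ b) +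
      prob p ({ω | Disjoint (clusterFinset ends o ω) {a₁, a₂}} ∩ connEvent ends a₁ b) := by
    have h1 := prob_inter_add_prob_inter_compl p (connEvent ends a₁ b) {ω | a₁ ∈ clusterFinset ends o ω}
    have h2 := prob_inter_add_prob_inter_compl p (connEvent ends a₁ b ∩ {ω | a₁ ∈ clusterFinset ends o ω}ᶜ)
      {ω | a₂ ∈ clusterFinset ends o ω}
    have ea : connEvent ends a₁ b ∩ {ω | a₁ ∈ clusterFinset ends o ω} =
        {ω | a₁ ∈ clusterFinset ends o ω} ∩ connEvent ends a₁ b := Set.inter_comm _ _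
    have eb : connEvent ends a₁ b ∩ {ω | a₁ ∈ clusterFinset ends o ω}ᶜ ∩ {ω | a₂ ∈ clusterFinset ends o ω} =
        {ω | a₁ ∉ clusterFinset ends o ω ∧ a₂ ∈ clusterFinset ends o ω} ∩ connEvent ends a₁ b := by
      ext ω; simp only [Set.mem_inter_iff, Set.mem_compl_iff, Set.mem_setOf_eq]; tauto
    have ec : connEvent ends a₁ b ∩ {ω | a₁ ∈ clusterFinset ends o ω}ᶜ ∩ {ω | a₂ ∈ clusterFinset ends o ω}ᶜ =
        {ω | Disjoint (clusterFinset ends o ω) {a₁, a₂}} ∩ connEvent ends a₁ b := by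
      ext ω
      simp only [Set.mem_inter_iff, Set.mem_compl_iff, Set.mem_setOf_eq, Finset.disjoint_insert_right,
        Finset.disjoint_singleton_right]
      tauto
    rw [ea] at h1
    rw [eb, ec] at h2
    linarith
  -- the three pieces
  have p1 : prob p ({ω | a₁ ∈ clusterFinset ends o ω} ∩ connEvent ends a₁ b) =
      prob p ({ω | a₁ ∈ clusterFinset ends o ω} ∩ connEvent ends o b) := by
    congr 1
    ext ω
    simp only [Set.mem_inter_iff, Set.mem_setOf_eq, mem_clusterFinset, mem_connEvent]
    constructor
    · rintro ⟨h1, h2⟩; exact ⟨h1, conn_trans h1 h2⟩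
    · rintro ⟨h1, h2⟩; exact ⟨h1, conn_trans (conn_symm h1) h2⟩
  have p2 : prob p ({ω | a₁ ∉ clusterFinset ends o ω ∧ a₂ ∈ clusterFinset ends o ω} ∩ connEvent ends a₁ b) =
      prob p (connEvent ends o a₂ ∩ connEvent ends a₁ b ∩ avoidAll ends a₂ {a₁, b}) := by
    congr 1
    ext ω
    simp only [Set.mem_inter_iff, Set.mem_setOf_eq, mem_clusterFinset, mem_connEvent, mem_avoidAll,
      Finset.mem_insert, Finset.mem_singleton, forall_eq_or_imp, forall_eq]
    constructor
    · rintro ⟨⟨h1, h2⟩, h3⟩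
      refine ⟨⟨h2, h3⟩, fun h => h1 (conn_trans h2 h), fun h => h1 (conn_trans (conn_trans h2 h) (conn_symm h3))⟩
    · rintro ⟨⟨h2, h3⟩, h4, _⟩
      exact ⟨⟨fun h => h4 (conn_trans (conn_symm h2) h), h2⟩, h3⟩
  have p3 : prob p ({ω | Disjoint (clusterFinset ends o ω) {a₁, a₂}} ∩ connEvent ends a₁ b) =
      gqTerm p ends {a₁, a₂} (Finset.insert_nonempty a₁ {a₂}) o b + lossTerm p ends o a₁ a₂ b := by
    rw [prob_inter_eq_sum_clusterEvent p ends o (fun W => Disjoint W {a₁, a₂})]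
    unfold gqTerm lossTerm
    rw [← Finset.sum_add_distrib]
    refine Finset.sum_congr rfl fun W hW => ?_
    have hW' := (Finset.mem_filter.1 hW).2
    have ha₁ : a₁ ∉ W := Finset.disjoint_right.1 hW' (Finset.mem_insert_self _ _)
    rw [prob_clusterEvent_inter_connEvent_eq_mul_connDel p ends o W ha₁, ← mul_add,
      Finset.inf'_insert (Finset.singleton_nonempty a₂), Finset.inf'_singleton]
    congr 1
    exact (min_add_max_sub _ _).symm
  -- the hitting event
  have hhit : prob p (hitEvent ends o {a₁, a₂} ∩ connEvent ends o b) =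
      prob p ({ω | a₁ ∈ clusterFinset ends o ω} ∩ connEvent ends o b) +
      prob p (connEvent ends o a₂ ∩ connEvent ends a₂ b ∩ (connEvent ends a₂ a₁)ᶜ) := by
    have h := prob_inter_add_prob_inter_compl p (hitEvent ends o {a₁, a₂} ∩ connEvent ends o b)
      (connEvent ends o a₁)
    have e1 : hitEvent ends o {a₁, a₂} ∩ connEvent ends o b ∩ connEvent ends o a₁ =
        {ω | a₁ ∈ clusterFinset ends o ω} ∩ connEvent ends o b := by
      ext ω
      constructor
      · rintro ⟨⟨_, hob⟩, hoa⟩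
        exact ⟨mem_clusterFinset.2 hoa, hob⟩
      · rintro ⟨hoa, hob⟩
        have hoa' : Conn ends ω o a₁ := mem_clusterFinset.1 hoa
        exact ⟨⟨⟨a₁, Finset.mem_insert_self _ _, hoa'⟩, hob⟩, hoa'⟩
    have e2 : hitEvent ends o {a₁, a₂} ∩ connEvent ends o b ∩ (connEvent ends o a₁)ᶜ =
        connEvent ends o a₂ ∩ connEvent ends a₂ b ∩ (connEvent ends a₂ a₁)ᶜ := by
      ext ω
      constructor
      · rintro ⟨⟨⟨a, ha, hc⟩, hob⟩, hno⟩
        rcases Finset.mem_insert.1 ha with rfl | ha'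
        · exact absurd hc hno
        · rw [Finset.mem_singleton] at ha'
          subst ha'
          exact ⟨⟨hc, conn_trans (conn_symm hc) hob⟩, fun h => hno (conn_trans hc h)⟩
      · rintro ⟨⟨h1, hab⟩, hna⟩
        exact ⟨⟨⟨a₂, Finset.mem_insert_of_mem (Finset.mem_singleton_self _), h1⟩,
          conn_trans h1 hab⟩, fun h => hna (conn_trans (conn_symm h1) h)⟩
    rw [e1, e2] at h
    linarith
  have t1 := t1_nonneg p hp ends o a₁ a₂ b
  unfold H2 at hH2
  rw [e0, p1, p2, p3, hhit]
  linarith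


omit [Fintype E] [DecidableEq E] [Fintype V] in
/-- `{a₁ ↔ b} ∩ {a₂ ↮ a₁} ∩ {a₂ ↮ b} = {a₁ ↔ b} ∩ {a₁ ↮ a₂}` (on `{a₁ ↔ b}`, `a₂ ↮ a₁ ⟺ a₂ ↮ b`). -/
lemma connEvent_inter_avoidAll_eq (ends : E → Sym2 V) (a₁ a₂ b : V) :
    connEvent ends a₁ b ∩ avoidAll ends a₂ {a₁, b} = connEvent ends a₁ b ∩ (connEvent ends a₁ a₂)ᶜ := by
  ext ω
  simp only [Set.mem_inter_iff, mem_connEvent, mem_avoidAll, Finset.mem_insert, Finset.mem_singleton,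
    forall_eq_or_imp, forall_eq, Set.mem_compl_iff]
  constructor
  · rintro ⟨h1, h2, _⟩
    exact ⟨h1, fun h => h2 (conn_symm h)⟩
  · rintro ⟨h1, h2⟩
    exact ⟨h1, fun h => h2 (conn_symm h), fun h => h2 (conn_trans h1 (conn_symm h))⟩

omit [Fintype E] [DecidableEq E] [Fintype V] in
/-- `avoidAll a₂ {a₁, b} = {a₂ ↮ b} ∩ {a₂ ↮ a₁}` (unfolding). -/
lemma avoidAll_pair_eq (ends : E → Sym2 V) (a₂ a₁ b : V) :
    avoidAll ends a₂ {a₁, b} = (connEvent ends a₂ b)ᶜ ∩ (connEvent ends a₂ a₁)ᶜ := by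
  ext ω
  simp only [mem_avoidAll, Finset.mem_insert, Finset.mem_singleton, forall_eq_or_imp, forall_eq,
    Set.mem_inter_iff, Set.mem_compl_iff, mem_connEvent]
  tauto

/-- **T2 ≥ 0** (lead, LEAD-PROOFSHAPES §8.7 (i)): under `P(a₁ ↔ b) ≤ P(a₂ ↔ b)`,
`ρ₀ · P(o ∈ U, a₁ ∉ U, b ∉ U) ≤ P(o ∈ U, b ∈ U, a₁ ∉ U)` with `U = C(a₂)` — the same-cluster BHK
inequality at the root `a₂` (events `{o ∈ U}`, `{b ∈ U}`, avoidance `a₁`) plus the order hypothesis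
in the form `P(a₁ ↔ b, a₁ ↮ a₂) ≤ P(a₂ ↔ b, a₂ ↮ a₁)`. -/
theorem t2_nonneg (p : E → R) (hp : IsProbVec p) (ends : E → Sym2 V) (o a₁ a₂ b : V)
    (hord : prob p (connEvent ends a₁ b) ≤ prob p (connEvent ends a₂ b)) :
    rhoZero p ends a₁ a₂ b * prob p (connEvent ends o a₂ ∩ avoidAll ends a₂ {a₁, b}) ≤
      prob p (connEvent ends o a₂ ∩ connEvent ends a₂ b ∩ (connEvent ends a₂ a₁)ᶜ) := by
  unfold rhoZero
  set D := (connEvent ends a₂ a₁)ᶜ with hD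
  -- BHK, same cluster: `P(E ∩ D) · P(F ∩ D) ≤ P(E ∩ F ∩ D) · P(D)`
  have bhk := bhk_same_cluster_events p hp ends a₂ a₁ (isUpperSet_mem_setOf o) (isUpperSet_mem_setOf b)
  rw [clusterInEvent_mem_eq_connEvent, clusterInEvent_mem_eq_connEvent, connEvent_comm ends b a₂] at bhk
  -- names
  set x := prob p (connEvent ends o a₂ ∩ connEvent ends a₂ b ∩ D)
  set y := prob p (connEvent ends o a₂ ∩ avoidAll ends a₂ {a₁, b})
  set f := prob p (connEvent ends a₂ b ∩ D)
  set g := prob p (avoidAll ends a₂ {a₁, b})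
  set r := prob p (connEvent ends a₁ b ∩ avoidAll ends a₂ {a₁, b})
  -- `P(E ∩ D) = x + y`, `P(D) = f + g`
  have hED : prob p (connEvent ends o a₂ ∩ D) = x + y := by
    have h := prob_inter_add_prob_inter_compl p (connEvent ends o a₂ ∩ D) (connEvent ends a₂ b)
    have e1 : connEvent ends o a₂ ∩ D ∩ connEvent ends a₂ b = connEvent ends o a₂ ∩ connEvent ends a₂ b ∩ D := by
      ext ω; simp only [Set.mem_inter_iff]; tauto
    have e2 : connEvent ends o a₂ ∩ D ∩ (connEvent ends a₂ b)ᶜ = connEvent ends o a₂ ∩ avoidAll ends a₂ {a₁, b} := by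
      rw [avoidAll_pair_eq]; ext ω; simp only [Set.mem_inter_iff]; tauto
    rw [e1, e2] at h
    linarith
  have hDfg : prob p D = f + g := by
    have h := prob_inter_add_prob_inter_compl p D (connEvent ends a₂ b)
    have e1 : D ∩ connEvent ends a₂ b = connEvent ends a₂ b ∩ D := Set.inter_comm _ _
    have e2 : D ∩ (connEvent ends a₂ b)ᶜ = avoidAll ends a₂ {a₁, b} := by
      rw [avoidAll_pair_eq]; exact Set.inter_comm _ _
    rw [e1, e2] at h
    linarith
  rw [hED, hDfg] at bhk
  -- the order hypothesis: `r ≤ f`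
  have hr : r ≤ f := by
    have h1 := prob_inter_add_prob_inter_compl p (connEvent ends a₁ b) (connEvent ends a₁ a₂)
    have h2 := prob_inter_add_prob_inter_compl p (connEvent ends a₂ b) (connEvent ends a₂ a₁)
    have e : connEvent ends a₁ b ∩ connEvent ends a₁ a₂ = connEvent ends a₂ b ∩ connEvent ends a₂ a₁ := by
      ext ω
      simp only [Set.mem_inter_iff, mem_connEvent]
      constructor
      · rintro ⟨h1, h2⟩; exact ⟨conn_trans (conn_symm h2) h1, conn_symm h2⟩
      · rintro ⟨h1, h2⟩; exact ⟨conn_trans (conn_symm h2) h1, conn_symm h2⟩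
    have er : r = prob p (connEvent ends a₁ b ∩ (connEvent ends a₁ a₂)ᶜ) := by
      simp only [r]; rw [connEvent_inter_avoidAll_eq]
    rw [e] at h1
    rw [er]
    linarith
  -- conclude
  have hg : 0 ≤ g := prob_nonneg hp _
  have hx : 0 ≤ x := prob_nonneg hp _
  have hy : 0 ≤ y := prob_nonneg hp _
  have hf : 0 ≤ f := prob_nonneg hp _
  rcases hg.lt_or_eq with hg0 | hg0
  · rw [div_mul_eq_mul_div, div_le_iff₀ hg0]
    nlinarith [bhk, hr, hy, hx, hf]
  · rw [← hg0, div_zero, zero_mul]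
    exact hx

end R4PlusTwo

end Summit.Ventures.PercRepro2
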